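import Summits.QuantumFields.BalabanUV.Beta.D1BFx.RestKernelFPUnit
import Summits.QuantumFields.BalabanUV.Beta.D1BFx.PackedColumnEnvelope
import Summits.QuantumFields.BalabanUV.Beta.D1BFx.BondTreeGaugeSharp

/-!
# `BalabanUV.Beta.D1BFx.RestKernelFPRoad` — road «BF-x» for binder row D1, slot (K), DICT-CHAIN-SPEC §2 (II) row RK-FP: **«RK-FP ROAD ROW CLOSED» —
# THE (5.10) ∕ (1.22) ROWS OF PART 7 ∕ 8's COMB-FP MEMBER AT THE ROAD's OWN WEIGHTS `colH G₀ (m+1)` WITH AN n-FREE CONSTANT AND AN n-FREE RATE,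
# NO DISPLAYED LETTER LEFT** — «RK-FP UNIT» (`RestKernelFPUnit.decay510_fpWord`, generic in the weight letter and in the sup letter `Λ`) INSTANTIATED at
# gan24-leaf-05 g53's two UNCONDITIONAL letters: «G0-COL-ENV» `PackedColumnEnvelope.abs_colH_G₀_road_le` (`|colH G₀ n μ y κ u| ≤ (n⁴)⁻¹·C_{G₀}·e^{−(κ∕16n)|u − n•y|₁}`,
# `κ = kappa163 4`, `C_{G₀} = (MG163 4·periodConst (kappa163 4) 3)·(1 + 8(1 + e^{κ∕4}))·e^{κ∕4}`) and «BMF-SHARP» `BondTreeGaugeSharp.abs_bmGaugeAt_delta1_le_two` (`Λ = 2`).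

HONEST DEPENDENCY (cell records, verbatim): «continuum YM on T⁴ ⇐ BetaPertH ∧ nine spine estimates (0/9 proved); BetaPertH ⇐ (D1) ∧ (D4) ∧
CAP+tail; G-an2-4 gates asym, D1 and NE2/3/4.»  HONEST FRAMING (cell contract, verbatim): «discharging `BetaPertH` makes Bałaban's UV stability
UNCONDITIONAL — a real constructive-QFT result; it is NOT the continuum limit and NOT the Clay problem.»  THIS MODULE DISCHARGES NOTHING of the
wall: [folklore] composition BY NAME + `Zl 4 c ≤ (1 + 2∕c)⁴` arithmetic.  What it closes is ONE ENTRY of the (II) ledger of the (K) slot: the comb-FP member's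
moment rows, whose inputs are OUR objects (`nFcol`, `colH G₀`, `idK1`) and the landed [folklore] envelopes of the one-shot minimiser (`FP.CompositeMinimiserDecay.abs_wH_le`
inside «G0-COL-ENV»).  No definition, no `def … : Prop`, no notation, nothing cited, 0 sorry.  0 root-level binders of row D1 discharged (hW ∕ hR-sockets ∕ hSX-socket ∕
D1Tel ∕ D1Rep — 0); (K) NOT closed ((K) ⇐ `hptw` via (J1)(J2)(J3) + the other five rest words' rows + `hU₁`); NOT D1, NOT `BetaPertH`, NOT continuum, NOT Clay.

ABSOLUTE RULE (cell charter, verbatim): «No internally-minted statement may enter as a cited fact. Every hypothesis is either kernel-proved in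
this package or a verbatim quotation of a PUBLISHED theorem with page reference. The manuscript(s) under audit are NOT citable for their own
disputed steps — they are the thing under adjudication; programme-internal (2001/route/tribunal) claims are never citable.»

CONTENT (all [folklore]; `n = m + 1`, `r ∈ box 4 n`, `κ := kappa163 4`, `C_{G₀}` as above, PART 8's member lambda VERBATIM):
* **`decay510_fpWord_G₀`** — `Decay510 (z ↦ 2·hessKer idK1 𝒳[colH G₀ n] 𝒳₂[colH G₀ n] μ ν z) (Kfp♯ n) (κ∕4∕(4n)∕2·n)` with `Kfp♯ n := 4·2·C²·Zl 4 (δ∕2) + (4·2·C·e^{(δ∕2)(4n+1)})²·Zl 4 (δ∕2∕2)²`,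
  `C = (n⁴)⁻¹·C_{G₀}`, `δ = κ∕4∕(4n)` («RK-FP UNIT» at `Λ := 2`, `hw := abs_colH_G₀_road_le`).
* **`Kfp_G₀_le`** — `Kfp♯ n ≤ KFP := 8·C_{G₀}²·(1 + 64∕κ)⁴ + 64·C_{G₀}²·e^{5κ∕16}·(1 + 128∕κ)⁸` for every `n ≥ 1` (tadpole `n⁻⁴`, bubble `n⁰`: `Zl 4 (κ∕(c·n)) ≤ n⁴(1+2c∕κ)⁴`).
* **`decay510_fpWord_G₀_unit`** — `Decay510 (…) KFP (κ∕32)`: n-FREE CONSTANT, n-FREE RATE; **`absMoment₂_fpWord_G₀`**; **`abs_secondMoment_fpWord_G₀_le`** —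
  `|secondMoment (…) μ ν| ≤ KFP·Σ'_x |x|₁²·e^{−(κ∕32)|x|₁}` for every `m`: THE FP MEMBER IS UNIT CLASS (its `hMR` ∕ `hRu` ∕ `hU` cells take NO letter).
NOT HERE (honest): the member's SIGN ∕ size (an absolute count; the tadpole–bubble cancellation is not used); the other five rest words; `hptw`; `TshotOf`.
Unit `b2b-balaban-beta-d1-formalise-leaf-04` (gen 20), road «BF-x»; INTENT 2 «RK-FP ROAD ROW CLOSED» (journal); letters by `b2b-balaban-gan24-formalise-leaf-05` (gen 53).
-/

noncomputable section

open scoped BigOperators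
open Literature.MathematicalPhysics.QuantumFieldTheory.Balaban1983to89
open Literature.MathematicalPhysics.QuantumFieldTheory.Balaban1983to89.Beta
open B12Sec2to5 (l1 l1_nonneg Decay510 secondMoment_abs_le_of_decay510)
open B5Hk163Strip (kappa163 kappa163_pos)
open B5Hk163Decay (MG163)
open B4TorusKernel (periodConst)
open DecimatedMomentSummable (AbsMoment₂ absMoment₂_of_decay510)
open ExpKernelCalculus (hessKer Zl Zl_nonneg decay510_mono_const)
open AffineAveraging (box toSite)
open OneStepResolventKernel (wsum)
open OneStepKernelFamily (KInvStep colH)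
open Summit.QuantumFields.BalabanUV.Beta.AxialDressingRooted (coDressKBmAt)
open Summit.QuantumFields.BalabanUV.Beta.D1BFx.GaugeJetLocal (idK1)
open Summit.QuantumFields.BalabanUV.Beta.D1BFx.CombFPWordArrays (nFcol)
open Summit.QuantumFields.BalabanUV.Beta.D1BFx.RestKernelFPUnit (decay510_fpWord Zl_coarse_rate_le)
open Summit.QuantumFields.BalabanUV.Beta.D1BFx.PackedColumnEnvelope (abs_colH_G₀_road_le colH_G₀_road_weight_nonneg)
open Summit.QuantumFields.BalabanUV.Beta.D1BFx.BondTreeGaugeSharp (abs_bmGaugeAt_delta1_le_two)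

namespace Summit.QuantumFields.BalabanUV.Beta.D1BFx.RestKernelFPRoad

variable (m : ℕ) {r : Fin 4 → ℕ}

/-- [folklore] **THE ROAD's FP MEMBER IS A (5.10)-KERNEL — NO DISPLAYED LETTER**: «RK-FP UNIT» at the sharp sup `Λ := 2` («BMF-SHARP») and the gauged
column envelope `C := (n⁴)⁻¹·C_{G₀}`, `δ := κ∕4∕(4n)` («G0-COL-ENV»); constant `Kfp♯ n`, rate `κ∕4∕(4n)∕2·n`. -/
theorem decay510_fpWord_G₀ (hr : r ∈ box (3 + 1) (m + 1)) (μ ν : Fin 4) :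
    Decay510 (fun z => 2 * hessKer idK1
          (fun κ' v => fun x y c b => ∑ κ : Fin 4, wsum (colH (coDressKBmAt (toSite r) (m + 1) (KInvStep (d := 3) (m + 1) 0)) (m + 1) κ' v κ) (nFcol r (m + 1) κ) x y c b)
          (fun κ' v l v' => fun x y c b => ∑ κ : Fin 4, wsum (colH (coDressKBmAt (toSite r) (m + 1) (KInvStep (d := 3) (m + 1) 0)) (m + 1) κ' v κ)
            (fun u => fun x y c b => colH (coDressKBmAt (toSite r) (m + 1) (KInvStep (d := 3) (m + 1) 0)) (m + 1) l v' κ u * nFcol r (m + 1) κ u x y c b) x y c b)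
          μ ν z)
      (4 * 2 * ((((m + 1 : ℕ) : ℝ) ^ 4)⁻¹ * ((MG163 4 * periodConst (kappa163 4) 3) * (1 + 8 * (1 + Real.exp (kappa163 4 / 4))) * Real.exp (kappa163 4 / 4)))
            * ((((m + 1 : ℕ) : ℝ) ^ 4)⁻¹ * ((MG163 4 * periodConst (kappa163 4) 3) * (1 + 8 * (1 + Real.exp (kappa163 4 / 4))) * Real.exp (kappa163 4 / 4)))
            * Zl 4 (kappa163 4 / 4 / (4 * ((m + 1 : ℕ) : ℝ)) / 2)
        + (4 * 2 * ((((m + 1 : ℕ) : ℝ) ^ 4)⁻¹ * ((MG163 4 * periodConst (kappa163 4) 3) * (1 + 8 * (1 + Real.exp (kappa163 4 / 4))) * Real.exp (kappa163 4 / 4)))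
              * Real.exp (kappa163 4 / 4 / (4 * ((m + 1 : ℕ) : ℝ)) / 2 * (4 * ((m + 1 : ℕ) : ℝ) + 1)))
          * (4 * 2 * ((((m + 1 : ℕ) : ℝ) ^ 4)⁻¹ * ((MG163 4 * periodConst (kappa163 4) 3) * (1 + 8 * (1 + Real.exp (kappa163 4 / 4))) * Real.exp (kappa163 4 / 4)))
              * Real.exp (kappa163 4 / 4 / (4 * ((m + 1 : ℕ) : ℝ)) / 2 * (4 * ((m + 1 : ℕ) : ℝ) + 1)))
          * Zl 4 (kappa163 4 / 4 / (4 * ((m + 1 : ℕ) : ℝ)) / 2 / 2) ^ 2)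
      (kappa163 4 / 4 / (4 * ((m + 1 : ℕ) : ℝ)) / 2 * ((m + 1 : ℕ) : ℝ)) :=
  decay510_fpWord hr (fun κ u x => abs_bmGaugeAt_delta1_le_two (Nat.le_add_left 1 m) (toSite r) κ u x)
    (fun κ' v κ u => abs_colH_G₀_road_le m hr κ' v κ u)
    (div_pos (div_pos (kappa163_pos 4) four_pos) (mul_pos four_pos (Nat.cast_pos.mpr (Nat.succ_pos m))))
    (colH_G₀_road_weight_nonneg m) μ ν

/-- [folklore] **THE n-FREE MAJORANT**: for every `n = m + 1`, `Kfp♯ n ≤ KFP := 8·C_{G₀}²·(1 + 64∕κ)⁴ + 64·C_{G₀}²·e^{5κ∕16}·(1 + 128∕κ)⁸` — the tadpole part is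
`≤ 8·C_{G₀}²·(1+64∕κ)⁴·n⁻⁴` (`Zl 4 (κ∕4∕(8n)) ≤ n⁴(1+64∕κ)⁴`, two factors `n⁻⁴`), the bubble part `≤ 64·C_{G₀}²·e^{5κ∕16}·(1+128∕κ)⁸` (`Zl 4 (κ∕4∕(16n))² ≤ n⁸(1+128∕κ)⁸`,
two factors `n⁻⁴`, window cost `e^{(κ∕4∕(4n))(4n+1)} ≤ e^{5κ∕16}`). -/
theorem Kfp_G₀_le :
    4 * 2 * ((((m + 1 : ℕ) : ℝ) ^ 4)⁻¹ * ((MG163 4 * periodConst (kappa163 4) 3) * (1 + 8 * (1 + Real.exp (kappa163 4 / 4))) * Real.exp (kappa163 4 / 4)))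
            * ((((m + 1 : ℕ) : ℝ) ^ 4)⁻¹ * ((MG163 4 * periodConst (kappa163 4) 3) * (1 + 8 * (1 + Real.exp (kappa163 4 / 4))) * Real.exp (kappa163 4 / 4)))
            * Zl 4 (kappa163 4 / 4 / (4 * ((m + 1 : ℕ) : ℝ)) / 2)
        + (4 * 2 * ((((m + 1 : ℕ) : ℝ) ^ 4)⁻¹ * ((MG163 4 * periodConst (kappa163 4) 3) * (1 + 8 * (1 + Real.exp (kappa163 4 / 4))) * Real.exp (kappa163 4 / 4)))
              * Real.exp (kappa163 4 / 4 / (4 * ((m + 1 : ℕ) : ℝ)) / 2 * (4 * ((m + 1 : ℕ) : ℝ) + 1)))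
          * (4 * 2 * ((((m + 1 : ℕ) : ℝ) ^ 4)⁻¹ * ((MG163 4 * periodConst (kappa163 4) 3) * (1 + 8 * (1 + Real.exp (kappa163 4 / 4))) * Real.exp (kappa163 4 / 4)))
              * Real.exp (kappa163 4 / 4 / (4 * ((m + 1 : ℕ) : ℝ)) / 2 * (4 * ((m + 1 : ℕ) : ℝ) + 1)))
          * Zl 4 (kappa163 4 / 4 / (4 * ((m + 1 : ℕ) : ℝ)) / 2 / 2) ^ 2
      ≤ 8 * ((MG163 4 * periodConst (kappa163 4) 3) * (1 + 8 * (1 + Real.exp (kappa163 4 / 4))) * Real.exp (kappa163 4 / 4)) ^ 2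
            * (1 + 64 / kappa163 4) ^ 4
        + 64 * ((MG163 4 * periodConst (kappa163 4) 3) * (1 + 8 * (1 + Real.exp (kappa163 4 / 4))) * Real.exp (kappa163 4 / 4)) ^ 2
            * Real.exp (5 * kappa163 4 / 16) * (1 + 128 / kappa163 4) ^ 8 := by
  -- letters
  set n : ℝ := ((m + 1 : ℕ) : ℝ) with hn
  set k : ℝ := kappa163 4 with hk
  set C₀ : ℝ := (MG163 4 * periodConst (kappa163 4) 3) * (1 + 8 * (1 + Real.exp (kappa163 4 / 4))) * Real.exp (kappa163 4 / 4) with hC₀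
  have hk0 : 0 < k := kappa163_pos 4
  have hn1 : (1 : ℝ) ≤ n := by rw [hn]; exact_mod_cast Nat.le_add_left 1 m
  have hn0 : (0 : ℝ) < n := by linarith
  have hn4 : (0 : ℝ) < n ^ 4 := by positivity
  have hC₀0 : 0 ≤ C₀ := by
    have h := colH_G₀_road_weight_nonneg m
    rw [← hn, ← hC₀] at h
    exact (mul_nonneg_iff_of_pos_left (inv_pos.mpr hn4)).1 h
  haveI : NeZero (m + 1) := ⟨Nat.succ_ne_zero m⟩
  -- the two lattice constants: `Zl 4 ((k/4)/(8n)) ≤ n⁴ (1 + 64/k)⁴`, `Zl 4 ((k/4)/(16n)) ≤ n⁴ (1 + 128/k)⁴`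
  have hZ2 : Zl 4 (k / 4 / (4 * n) / 2) ≤ n ^ 4 * (1 + 64 / k) ^ 4 := by
    have h := Zl_coarse_rate_le (n := m + 1) (δ₀ := k / 4) (c := 8) (by positivity) (by norm_num)
    rw [← hn] at h
    rw [show k / 4 / (4 * n) / 2 = k / 4 / (8 * n) by field_simp; ring]
    refine h.trans (le_of_eq ?_)
    rw [show (2 : ℝ) * 8 / (k / 4) = 64 / k by field_simp; ring]
  have hZ4 : Zl 4 (k / 4 / (4 * n) / 2 / 2) ≤ n ^ 4 * (1 + 128 / k) ^ 4 := by
    have h := Zl_coarse_rate_le (n := m + 1) (δ₀ := k / 4) (c := 16) (by positivity) (by norm_num)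
    rw [← hn] at h
    rw [show k / 4 / (4 * n) / 2 / 2 = k / 4 / (16 * n) by field_simp; ring]
    refine h.trans (le_of_eq ?_)
    rw [show (2 : ℝ) * 16 / (k / 4) = 128 / k by field_simp; ring]
  have hZ4' : 0 ≤ Zl 4 (k / 4 / (4 * n) / 2 / 2) := Zl_nonneg (by positivity)
  -- the window cost
  have hW : Real.exp (k / 4 / (4 * n) / 2 * (4 * n + 1)) * Real.exp (k / 4 / (4 * n) / 2 * (4 * n + 1)) ≤ Real.exp (5 * k / 16) := by
    rw [← Real.exp_add, Real.exp_le_exp]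
    have e : k / 4 / (4 * n) / 2 * (4 * n + 1) = k / 8 + k / (32 * n) := by field_simp; ring
    have h2 : k / (32 * n) ≤ k / 32 := div_le_div_of_nonneg_left hk0.le (by norm_num) (by linarith)
    rw [e]; linarith
  -- tadpole part
  have hA : 4 * 2 * ((n ^ 4)⁻¹ * C₀) * ((n ^ 4)⁻¹ * C₀) * Zl 4 (k / 4 / (4 * n) / 2) ≤ 8 * C₀ ^ 2 * (1 + 64 / k) ^ 4 := by
    calc 4 * 2 * ((n ^ 4)⁻¹ * C₀) * ((n ^ 4)⁻¹ * C₀) * Zl 4 (k / 4 / (4 * n) / 2)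
        ≤ 4 * 2 * ((n ^ 4)⁻¹ * C₀) * ((n ^ 4)⁻¹ * C₀) * (n ^ 4 * (1 + 64 / k) ^ 4) := mul_le_mul_of_nonneg_left hZ2 (by positivity)
      _ = (8 * C₀ ^ 2 * (1 + 64 / k) ^ 4) * (n ^ 4)⁻¹ := by field_simp; ring
      _ ≤ (8 * C₀ ^ 2 * (1 + 64 / k) ^ 4) * 1 :=
          mul_le_mul_of_nonneg_left (inv_le_one_of_one_le₀ (one_le_pow₀ hn1)) (by positivity)
      _ = _ := mul_one _
  -- bubble part
  have hB : (4 * 2 * ((n ^ 4)⁻¹ * C₀) * Real.exp (k / 4 / (4 * n) / 2 * (4 * n + 1)))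
        * (4 * 2 * ((n ^ 4)⁻¹ * C₀) * Real.exp (k / 4 / (4 * n) / 2 * (4 * n + 1))) * Zl 4 (k / 4 / (4 * n) / 2 / 2) ^ 2
      ≤ 64 * C₀ ^ 2 * Real.exp (5 * k / 16) * (1 + 128 / k) ^ 8 := by
    have hsq : Zl 4 (k / 4 / (4 * n) / 2 / 2) ^ 2 ≤ (n ^ 4 * (1 + 128 / k) ^ 4) ^ 2 := pow_le_pow_left₀ hZ4' hZ4 2
    calc (4 * 2 * ((n ^ 4)⁻¹ * C₀) * Real.exp (k / 4 / (4 * n) / 2 * (4 * n + 1)))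
          * (4 * 2 * ((n ^ 4)⁻¹ * C₀) * Real.exp (k / 4 / (4 * n) / 2 * (4 * n + 1))) * Zl 4 (k / 4 / (4 * n) / 2 / 2) ^ 2
        = (64 * ((n ^ 4)⁻¹) ^ 2 * C₀ ^ 2) * (Real.exp (k / 4 / (4 * n) / 2 * (4 * n + 1)) * Real.exp (k / 4 / (4 * n) / 2 * (4 * n + 1)))
            * Zl 4 (k / 4 / (4 * n) / 2 / 2) ^ 2 := by ring
      _ ≤ (64 * ((n ^ 4)⁻¹) ^ 2 * C₀ ^ 2) * Real.exp (5 * k / 16) * (n ^ 4 * (1 + 128 / k) ^ 4) ^ 2 :=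
          mul_le_mul (mul_le_mul_of_nonneg_left hW (by positivity)) hsq (by positivity) (by positivity)
      _ = 64 * C₀ ^ 2 * Real.exp (5 * k / 16) * (1 + 128 / k) ^ 8 := by field_simp
  exact add_le_add hA hB

/-- [folklore] **THE ROAD's FP MEMBER IS A (5.10)-KERNEL WITH AN n-FREE CONSTANT AND AN n-FREE RATE**: `Decay510 (…) KFP (κ∕32)` for every `m`. -/
theorem decay510_fpWord_G₀_unit (hr : r ∈ box (3 + 1) (m + 1)) (μ ν : Fin 4) :
    Decay510 (fun z => 2 * hessKer idK1
          (fun κ' v => fun x y c b => ∑ κ : Fin 4, wsum (colH (coDressKBmAt (toSite r) (m + 1) (KInvStep (d := 3) (m + 1) 0)) (m + 1) κ' v κ) (nFcol r (m + 1) κ) x y c b)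
          (fun κ' v l v' => fun x y c b => ∑ κ : Fin 4, wsum (colH (coDressKBmAt (toSite r) (m + 1) (KInvStep (d := 3) (m + 1) 0)) (m + 1) κ' v κ)
            (fun u => fun x y c b => colH (coDressKBmAt (toSite r) (m + 1) (KInvStep (d := 3) (m + 1) 0)) (m + 1) l v' κ u * nFcol r (m + 1) κ u x y c b) x y c b)
          μ ν z)
      (8 * ((MG163 4 * periodConst (kappa163 4) 3) * (1 + 8 * (1 + Real.exp (kappa163 4 / 4))) * Real.exp (kappa163 4 / 4)) ^ 2
            * (1 + 64 / kappa163 4) ^ 4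
        + 64 * ((MG163 4 * periodConst (kappa163 4) 3) * (1 + 8 * (1 + Real.exp (kappa163 4 / 4))) * Real.exp (kappa163 4 / 4)) ^ 2
            * Real.exp (5 * kappa163 4 / 16) * (1 + 128 / kappa163 4) ^ 8)
      (kappa163 4 / 32) := by
  have h := decay510_mono_const (decay510_fpWord_G₀ m hr μ ν) (Kfp_G₀_le m)
  have hn0 : (0 : ℝ) < ((m + 1 : ℕ) : ℝ) := Nat.cast_pos.mpr (Nat.succ_pos m)
  have e : kappa163 4 / 4 / (4 * ((m + 1 : ℕ) : ℝ)) / 2 * ((m + 1 : ℕ) : ℝ) = kappa163 4 / 32 := by field_simp; ring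
  rw [e] at h
  exact h

/-- [folklore] **THE `hMR` ROW** (also `RestKernelFPUnit.absMoment₂_fpWord_road`): absolutely summable second moments. -/
theorem absMoment₂_fpWord_G₀ (hr : r ∈ box (3 + 1) (m + 1)) (μ ν : Fin 4) :
    AbsMoment₂ (fun z => 2 * hessKer idK1
          (fun κ' v => fun x y c b => ∑ κ : Fin 4, wsum (colH (coDressKBmAt (toSite r) (m + 1) (KInvStep (d := 3) (m + 1) 0)) (m + 1) κ' v κ) (nFcol r (m + 1) κ) x y c b)
          (fun κ' v l v' => fun x y c b => ∑ κ : Fin 4, wsum (colH (coDressKBmAt (toSite r) (m + 1) (KInvStep (d := 3) (m + 1) 0)) (m + 1) κ' v κ)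
            (fun u => fun x y c b => colH (coDressKBmAt (toSite r) (m + 1) (KInvStep (d := 3) (m + 1) 0)) (m + 1) l v' κ u * nFcol r (m + 1) κ u x y c b) x y c b)
          μ ν z) :=
  absMoment₂_of_decay510 (div_pos (kappa163_pos 4) (by norm_num)) (decay510_fpWord_G₀_unit m hr μ ν)

/-- [folklore] **THE UNIT ROW OF THE ROAD's FP MEMBER — CLOSED, NO LETTER**: for every `m` and every root in the box,
`|secondMoment (2·hessKer idK1 𝒳[colH G₀ (m+1)] 𝒳₂[colH G₀ (m+1)]) μ ν| ≤ KFP · Σ'_x |x|₁²·e^{−(κ∕32)|x|₁}` — right member independent of `m`. -/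
theorem abs_secondMoment_fpWord_G₀_le (hr : r ∈ box (3 + 1) (m + 1)) (μ ν : Fin 4) :
    |B12Beta.secondMoment (fun μ ν z => 2 * hessKer idK1
          (fun κ' v => fun x y c b => ∑ κ : Fin 4, wsum (colH (coDressKBmAt (toSite r) (m + 1) (KInvStep (d := 3) (m + 1) 0)) (m + 1) κ' v κ) (nFcol r (m + 1) κ) x y c b)
          (fun κ' v l v' => fun x y c b => ∑ κ : Fin 4, wsum (colH (coDressKBmAt (toSite r) (m + 1) (KInvStep (d := 3) (m + 1) 0)) (m + 1) κ' v κ)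
            (fun u => fun x y c b => colH (coDressKBmAt (toSite r) (m + 1) (KInvStep (d := 3) (m + 1) 0)) (m + 1) l v' κ u * nFcol r (m + 1) κ u x y c b) x y c b)
          μ ν z) μ ν|
      ≤ (8 * ((MG163 4 * periodConst (kappa163 4) 3) * (1 + 8 * (1 + Real.exp (kappa163 4 / 4))) * Real.exp (kappa163 4 / 4)) ^ 2
            * (1 + 64 / kappa163 4) ^ 4
          + 64 * ((MG163 4 * periodConst (kappa163 4) 3) * (1 + 8 * (1 + Real.exp (kappa163 4 / 4))) * Real.exp (kappa163 4 / 4)) ^ 2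
            * Real.exp (5 * kappa163 4 / 16) * (1 + 128 / kappa163 4) ^ 8)
        * ∑' x : Fin 4 → ℤ, l1 x ^ 2 * Real.exp (-(kappa163 4 / 32) * l1 x) :=
  (secondMoment_abs_le_of_decay510 (P := fun μ ν z => 2 * hessKer idK1
      (fun κ' v => fun x y c b => ∑ κ : Fin 4, wsum (colH (coDressKBmAt (toSite r) (m + 1) (KInvStep (d := 3) (m + 1) 0)) (m + 1) κ' v κ) (nFcol r (m + 1) κ) x y c b)
      (fun κ' v l v' => fun x y c b => ∑ κ : Fin 4, wsum (colH (coDressKBmAt (toSite r) (m + 1) (KInvStep (d := 3) (m + 1) 0)) (m + 1) κ' v κ)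
        (fun u => fun x y c b => colH (coDressKBmAt (toSite r) (m + 1) (KInvStep (d := 3) (m + 1) 0)) (m + 1) l v' κ u * nFcol r (m + 1) κ u x y c b) x y c b)
      μ ν z) (div_pos (kappa163_pos 4) (by norm_num)) (decay510_fpWord_G₀_unit m hr μ ν)).2

end Summit.QuantumFields.BalabanUV.Beta.D1BFx.RestKernelFPRoad

end
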